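import Summits.CriticalPhenomena.PercolationContinuityZ3.Theorems.PercNearOneGluingNoHeavyQuantBlockCombCrossingClass
import Summits.CriticalPhenomena.PercolationContinuityZ3.Theorems.PercNearOneGluingNoHeavyQuantFarTreeRowBlockCombStrong
import HarnessLib

/-!
# QUANT lane R8, FAR on trees: the CANONICAL-TO-TREE TRANSPORT for block-combs (any inequality proved for p1's canonical model transfers to
# `Quant.FarTreeRow`'s coordinates and to the route vocabulary) — and the CLASS `|A|·x > 2j` as its first passenger

builds on p205010 (kernel theorem, internal audit signed; external expert review pending)

Support file (`--supports stmt-CriticalPhenomena-4575`), QUANT lane typer seat prim-quant-stmt (gen 15), rung R8 of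
`run/shared/lean/prim/quant/LADDER.md`; lead g12 asks (lane INBOX 2026-08-21T01:02Z/01:25Z: "W1/W2 need only transport p1's strong form AND this class
form"; "add the corollary for the class").  Theorems only; no definitions (the `local notation3` `CB[a, p, m]` of `…QuantBlobWalk.lean`, verbatim),
no sorries, standard axioms.

The R8 provers now work in p1 g8's CANONICAL block-comb model (`…QuantBlockCombMergeModel.lean`: chain gates `q`, levels `lv`, sizes `a`, private
gates `g`, explicit tail `TAIL`); the targets `Quant.FarTreeRow` / `Quant.FarRelayRow` live in gate coordinates (ancestor finsets `P`, relay set `A`)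
and in the route vocabulary (tree-supported bond weights on `Sym2 (Fin n)`).  This file makes the passage once and for all:

* `Quant.farTree_blockComb_heavy_ge_of_crossing` — **the transport**: for a block-comb around `a ∈ A` (forest axioms, `P b ≠ P b' → P b ∩ P b' ⊆ P a`
  on `A`) and a layer `j`, a real `B` is `≤ P(#{y ∈ A : ↑(P y) ⊆ ω} ≥ j+1)` as soon as `B ≤ Σ_{k<M} W k p k (CB[sz,p,k] j − CB[sz,p,k](j − sz k))`
  for EVERY levelled canonical datum `(M, qc, sz, p)` REALISED by the comb — chain gates `qc i ∈ [0,1]` (products over the chain segments), blob `k`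
  = a relay class `b ∈ A` with `sz k = #class`, `W k = ∏_{i≤k} qc i = ∏_{P b ∩ P a} q`, `p k = ∏_{P b ∖ P a} q`, the last blob the terminal class
  (`W = ∏_{P a} q`, `p = 1`), `Σ sz = |A|`.  (Crossing form; a `TAIL`-form theorem is converted on the canonical side by
  `Quant.BlockComb.tail_eq_crossing`, cf. `Quant.BlockComb.le_crossing_of_class`.)  Proof = the typer's count law `Quant.blockComb_count_eq` on the
  root-first enumeration of the classes + the segment chain of `…QuantFarTreeRowBlockCombStrong.lean`.
* `Quant.farTree_blockComb_of_classBudget` — **FAR AT EVERY LAYER FOR EVERY BLOCK-COMB IN THE CLASS `2j < |A| · ∏_{P a} q`** (`a` least likely;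
  arbitrary private gates, chain weights, sizes, terminal block): `P(#{b ∈ A : ↑(P b) ⊆ ω} ≤ j) ≤ t` whenever `1 − ∏_{P a} q ≤ t` — lead g12's
  `Quant.BlockComb.tail_ge_of_class` (p243788) through the transport.  It contains the equal-gate family, (GBS)/(FO′)-mono, the withdrawn (2L)
  residual programme, and bottom/top room INSIDE the class; what remains OPEN for block-combs is the BUDGET-BINDING regime `|A|·x ≤ 2j < EN`
  (LEAD-NOTES-G10 N21 (6); lead g12's normal form).
* `Quant.farTree_blockComb_of_classBudget_essential`, `Quant.farRelayRow_tree_blockComb_of_classBudget` — essential ancestor sets; **route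
  vocabulary** (`o ∉ A`): `2j < |A| · P(o ↔ a)` for a least likely `a`, `P(o ↮ b) ≤ t` on `A` ⟹ `P(#{b ∈ A | o ↔ b} ≤ j) ≤ t`.
[this work]; [cite: KozmaNitzan2024, Conjecture 3 (p. 15)] (the gluing rows served); product measure [cite: Grimmett1999, §1.3 p. 10].
-/

noncomputable section

namespace Summit.CriticalPhenomena.PercolationContinuityZ3.Theorems

namespace Quant

open Finset MeasureTheory
open Literature.Probability.LatticeModels
open Literature.Probability.Percolation
open scoped Classical

/-- `CB[a, p, m] t` = probability that the open mass of the first `m` blobs (sizes `a`, gates `p`) is `≤ t` (the recursion of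
`…QuantBlobWalk.lean`, verbatim). -/
local notation3 "CB[" a ", " p ", " m "]" =>
  (Nat.rec (motive := fun _ => ℤ → ℝ) (fun t => if (0 : ℤ) ≤ t then (1 : ℝ) else 0)
    (fun n f t => (p : ℕ → ℝ) n * f (t - ((a : ℕ → ℕ) n : ℤ)) + (1 - (p : ℕ → ℝ) n) * f t) (m : ℕ))

variable {ι : Type*} [Fintype ι] [DecidableEq ι]

/-! ### The transport -/

/-- **Canonical-to-tree transport for block-combs.**  Ancestor finsets `P` of a rooted forest (`y ∈ P x → P y ⊆ P x`; members of `P x` pairwise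
comparable), gates `q`, relays `A ∋ a`, BLOCK-COMB around `a` (`P b ≠ P b' → P b ∩ P b' ⊆ P a` on `A`), a layer `j` and a real `B`.  Suppose that
`B ≤ Σ_{k<M} (∏_{i≤k} qc i)·p k·(CB[sz,p,k] j − CB[sz,p,k](j − sz k))` for every levelled canonical datum `(M, qc, sz, p)` realised by the comb:
`qc i, p k ∈ [0,1]`, `Σ_{k<M} sz k = |A|`, `M ≥ 1`, the last blob is the terminal class (`∏_{i<M} qc i = ∏_{P a} q`, `p (M−1) = 1`,
`cls (M−1) = P a`), every blob `k < M` is the class `cls k = P b` of some `b ∈ A` (`sz k = #{y ∈ A | P y = cls k}`, `∏_{i≤k} qc i = ∏_{P b ∩ P a} q`,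
`p k = ∏_{P b ∖ P a} q`, `(∏_{i≤k} qc i)·p k = ∏_{P b} q`), the classes are distinct and cover `A`, and the mean is
`Σ_{k<M} sz k·(∏_{i≤k} qc i)·p k = Σ_{y∈A} ∏_{P y} q`.  Then `B ≤ P(#{y ∈ A : ↑(P y) ⊆ ω} ≥ j+1)`. [this work] -/
theorem farTree_blockComb_heavy_ge_of_crossing (P : ι → Finset ι)
    (h2 : ∀ x, ∀ y ∈ P x, P y ⊆ P x) (h3 : ∀ x, ∀ y ∈ P x, ∀ z ∈ P x, y ∈ P z ∨ z ∈ P y)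
    (q : ι → unitInterval) (A : Finset ι) (a : ι) (ha : a ∈ A)
    (hcomb : ∀ b ∈ A, ∀ b' ∈ A, P b ≠ P b' → P b ∩ P b' ⊆ P a) (j : ℕ) (B : ℝ)
    (hB : ∀ (M : ℕ) (qc : ℕ → ℝ) (sz : ℕ → ℕ) (p : ℕ → ℝ) (cls : ℕ → Finset ι),
      (∀ i, 0 ≤ qc i ∧ qc i ≤ 1) → (∀ k, 0 ≤ p k ∧ p k ≤ 1) →
      (((∑ k ∈ Finset.range M, sz k : ℕ) : ℝ) = A.card) → 0 < M →
      ((∏ i ∈ Finset.range M, qc i) = ∏ y ∈ P a, (q y : ℝ) ∧ p (M - 1) = 1 ∧ cls (M - 1) = P a) →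
      (∀ k, k < M → ∃ b ∈ A, P b = cls k ∧ sz k = (A.filter fun y => P y = cls k).card ∧
          (∏ i ∈ Finset.range (k + 1), qc i) = ∏ y ∈ P b ∩ P a, (q y : ℝ) ∧ p k = ∏ y ∈ P b \ P a, (q y : ℝ) ∧
          (∏ i ∈ Finset.range (k + 1), qc i) * p k = ∏ y ∈ P b, (q y : ℝ)) →
      (∀ k k', k < M → k' < M → cls k = cls k' → k = k') →
      (∀ y ∈ A, ∃ k, k < M ∧ P y = cls k) →
      (∑ k ∈ Finset.range M, (sz k : ℝ) * ((∏ i ∈ Finset.range (k + 1), qc i) * p k) = ∑ y ∈ A, ∏ z ∈ P y, (q z : ℝ)) →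
      B ≤ ∑ k ∈ Finset.range M, (∏ i ∈ Finset.range (k + 1), qc i) * p k *
          (CB[sz, p, k] (j : ℤ) - CB[sz, p, k] ((j : ℤ) - (sz k : ℤ)))) :
    B ≤ (prodBernoulli q).real
        {ω : Set ι | (j : ℤ) + 1 ≤ (((A.filter fun y => ((P y : Finset ι) : Set ι) ⊆ ω).card : ℕ) : ℤ)} := by
  have hq0 : ∀ y, (0 : ℝ) ≤ q y := fun y => (q y).2.1
  have hq1 : ∀ y, (q y : ℝ) ≤ 1 := fun y => (q y).2.2
  have hprod01 : ∀ s : Finset ι, 0 ≤ ∏ y ∈ s, (q y : ℝ) ∧ ∏ y ∈ s, (q y : ℝ) ≤ 1 := fun s =>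
    ⟨Finset.prod_nonneg fun y _ => hq0 y, Finset.prod_le_one (fun y _ => hq0 y) fun y _ => hq1 y⟩
  -- enumerate the fibres of `P` off the terminal block, root-first (as in `Quant.farTree_blockComb_equalGates`)
  set S : Finset (Finset ι) := (A.image P).erase (P a) with hS
  obtain ⟨Q, hQmem, hQinj, hQcov, hQmono⟩ :=
    exists_enum_mono (fun Q : Finset ι => (Q ∩ P a).card) (P a) S.card S rfl
  set K := S.card with hK
  have hQS : ∀ k, k < K → Q k ≠ P a ∧ ∃ y ∈ A, P y = Q k := fun k hk => by
    obtain ⟨hne, hmem⟩ := Finset.mem_erase.1 (hQmem k hk)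
    obtain ⟨y, hy, hyQ⟩ := Finset.mem_image.1 hmem
    exact ⟨hne, y, hy, hyQ⟩
  set x : ℝ := ∏ y ∈ P a, (q y : ℝ) with hx
  set sz : ℕ → ℕ := fun k => (A.filter fun y => P y = Q k).card with hsz
  set c : ℕ := (A.filter fun y => P y = P a).card with hc
  set p : ℕ → ℝ := fun k => ∏ y ∈ Q k \ P a, (q y : ℝ) with hp
  set w : ℕ → ℝ := fun k => ∏ y ∈ Q k ∩ P a, (q y : ℝ) with hw
  have hcover : ∀ y ∈ A, P y = P a ∨ ∃ k, k < K ∧ P y = Q k := by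
    intro y hy
    by_cases h : P y = P a
    · exact Or.inl h
    · obtain ⟨k, hk, hkQ⟩ := hQcov (P y) (Finset.mem_erase.2 ⟨h, Finset.mem_image_of_mem P hy⟩)
      exact Or.inr ⟨k, hk, hkQ.symm⟩
  have hmono : ∀ k k', k ≤ k' → k' < K → Q k ∩ P a ⊆ Q k' ∩ P a := by
    intro k k' hkk' hk'
    obtain ⟨_, y, _, hyQ⟩ := hQS k (by omega)
    obtain ⟨_, y', _, hy'Q⟩ := hQS k' hk'
    rw [← hyQ, ← hy'Q]
    refine subset_of_nested_of_card_le (comb_downsets_nested P h2 h3 a y y') ?_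
    rw [hyQ, hy'Q]; exact hQmono k k' hkk' hk'
  have hdisj : ∀ k k', k < K → k' < K → k ≠ k' → Q k ∩ Q k' ⊆ P a := by
    intro k k' hk hk' hne
    obtain ⟨_, y, hy, hyQ⟩ := hQS k hk
    obtain ⟨_, y', hy', hy'Q⟩ := hQS k' hk'
    rw [← hyQ, ← hy'Q]
    refine hcomb y hy y' hy' fun h => hne (hQinj k k' hk hk' ?_)
    rw [← hyQ, ← hy'Q, h]
  have hp01 : ∀ k, 0 ≤ p k ∧ p k ≤ 1 := fun k => hprod01 _
  -- the count law at `t = j`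
  have hcount := blockComb_count_eq P q a x hx K A Q sz c p w ha hc (fun k _ => rfl) hcover (fun k hk => (hQS k hk).1) hQinj hmono
    hdisj (fun k => rfl) (fun k => rfl) (j : ℤ) (Int.natCast_nonneg j)
  rw [hcount]
  -- the levelled model: blobs `0..K−1` and the terminal block as blob `K`, on the segment chain
  set sz' : ℕ → ℕ := fun k => if k < K then sz k else c with hsz'
  set p' : ℕ → ℝ := fun k => if k < K then p k else 1 with hp'
  set C : ℕ → Finset ι := fun k => if k < K then Q k ∩ P a else P a with hC
  set qc : ℕ → ℝ := fun i => ∏ y ∈ C i \ (if i = 0 then ∅ else C (i - 1)), (q y : ℝ) with hqc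
  have hp'01 : ∀ k, 0 ≤ p' k ∧ p' k ≤ 1 := fun k => by
    by_cases hk : k < K
    · simp only [hp', if_pos hk]; exact hp01 k
    · simp only [hp', if_neg hk]; norm_num
  have hqc01 : ∀ i, 0 ≤ qc i ∧ qc i ≤ 1 := fun i => hprod01 _
  have hCmono : ∀ k, k + 1 ≤ K → C k ⊆ C (k + 1) := by
    intro k hk
    by_cases hk' : k + 1 < K
    · simp only [hC, if_pos (show k < K by omega), if_pos hk']
      exact hmono k (k + 1) (by omega) hk'
    · simp only [hC, if_pos (show k < K by omega), if_neg hk']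
      exact Finset.inter_subset_right
  have hW : ∀ k, k ≤ K → ∏ i ∈ Finset.range (k + 1), qc i = ∏ y ∈ C k, (q y : ℝ) :=
    prod_segments_eq C K hCmono (fun y => (q y : ℝ))
  have hWk : ∀ k, k < K → (∏ i ∈ Finset.range (k + 1), qc i) = w k := fun k hk => by
    rw [hW k hk.le]; simp only [hC, if_pos hk, hw]
  have hWK : (∏ i ∈ Finset.range (K + 1), qc i) = x := by
    rw [hW K le_rfl]; simp only [hC, lt_irrefl, if_false, hx]
  -- total size `Σ sz + c = |A|` (the marginal bookkeeping at unit gates)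
  have htot : ((∑ k' ∈ Finset.range (K + 1), sz' k' : ℕ) : ℝ) = A.card := by
    have h1 := blockComb_sum_marginals P (fun _ => (1 : unitInterval)) a K A Q sz c hc (fun k _ => rfl) hcover
      (fun k hk => (hQS k hk).1) hQinj
    simp only [Set.Icc.coe_one, Finset.prod_const_one, mul_one, Finset.sum_const, nsmul_eq_mul] at h1
    have h2 : ∑ k' ∈ Finset.range (K + 1), sz' k' = (∑ k' ∈ Finset.range K, sz k') + c := by
      rw [Finset.sum_range_succ]
      congr 1
      · exact Finset.sum_congr rfl fun k hk => by simp only [hsz', if_pos (Finset.mem_range.1 hk)]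
      · simp only [hsz', lt_irrefl, if_false]
    rw [h2, h1]; push_cast; ring
  -- every blob of the levelled model is a relay class
  set cls : ℕ → Finset ι := fun k => if k < K then Q k else P a with hcls
  have hreal : ∀ k, k < K + 1 → ∃ b ∈ A, P b = cls k ∧ sz' k = (A.filter fun y => P y = cls k).card ∧
      (∏ i ∈ Finset.range (k + 1), qc i) = ∏ y ∈ P b ∩ P a, (q y : ℝ) ∧ p' k = ∏ y ∈ P b \ P a, (q y : ℝ) ∧
      (∏ i ∈ Finset.range (k + 1), qc i) * p' k = ∏ y ∈ P b, (q y : ℝ) := by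
    intro k hk
    by_cases hkK : k < K
    · obtain ⟨_, b, hb, hbQ⟩ := hQS k hkK
      refine ⟨b, hb, ?_, ?_, ?_, ?_, ?_⟩
      · simp only [hcls, if_pos hkK, hbQ]
      · simp only [hsz', if_pos hkK, hsz, hcls]
      · rw [hWk k hkK, hbQ]
      · simp only [hp', if_pos hkK, hp, hbQ]
      · rw [hWk k hkK, hbQ]; simp only [hp', if_pos hkK, hw, hp]
        exact Finset.prod_inter_mul_prod_sdiff (Q k) (P a) fun z => (q z : ℝ)
    · have hkK' : k = K := by omega
      subst hkK'
      refine ⟨a, ha, ?_, ?_, ?_, ?_, ?_⟩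
      · simp only [hcls, lt_irrefl, if_false]
      · simp only [hsz', hcls, lt_irrefl, if_false, hc]
      · rw [hWK, Finset.inter_self]
      · simp only [hp', lt_irrefl, if_false, Finset.sdiff_self, Finset.prod_empty]
      · rw [hWK]; simp only [hp', lt_irrefl, if_false, mul_one, hx]
  have hterm : (∏ i ∈ Finset.range (K + 1), qc i) = ∏ y ∈ P a, (q y : ℝ) ∧ p' (K + 1 - 1) = 1 ∧ cls (K + 1 - 1) = P a :=
    ⟨hWK, by simp only [Nat.add_sub_cancel, hp', lt_irrefl, if_false], by simp only [Nat.add_sub_cancel, hcls, lt_irrefl, if_false]⟩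
  have hclsinj : ∀ k k', k < K + 1 → k' < K + 1 → cls k = cls k' → k = k' := by
    intro k k' hk hk' h
    by_cases hkK : k < K <;> by_cases hkK' : k' < K
    · simp only [hcls, if_pos hkK, if_pos hkK'] at h; exact hQinj k k' hkK hkK' h
    · simp only [hcls, if_pos hkK, if_neg hkK'] at h; exact absurd h (hQS k hkK).1
    · simp only [hcls, if_neg hkK, if_pos hkK'] at h; exact absurd h.symm (hQS k' hkK').1
    · omega
  have hclscov : ∀ y ∈ A, ∃ k, k < K + 1 ∧ P y = cls k := by
    intro y hy
    rcases hcover y hy with h | ⟨k, hk, hky⟩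
    · exact ⟨K, by omega, by simp only [hcls, lt_irrefl, if_false]; exact h⟩
    · exact ⟨k, by omega, by simp only [hcls, if_pos hk]; exact hky⟩
  have hEN : ∑ k ∈ Finset.range (K + 1), (sz' k : ℝ) * ((∏ i ∈ Finset.range (k + 1), qc i) * p' k) =
      ∑ y ∈ A, ∏ z ∈ P y, (q z : ℝ) := by
    rw [blockComb_sum_marginals P q a K A Q sz c hc (fun k _ => rfl) hcover (fun k hk => (hQS k hk).1) hQinj,
      Finset.sum_range_succ, hWK]
    simp only [hsz', hp', lt_irrefl, if_false, mul_one]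
    rw [add_comm]
    congr 1
    refine Finset.sum_congr rfl fun k hk => ?_
    have hkK := Finset.mem_range.1 hk
    rw [if_pos hkK, hWk k hkK, if_pos hkK]
    simp only [hw, hp]
    rw [Finset.prod_inter_mul_prod_sdiff (Q k) (P a) fun z => (q z : ℝ)]
  have hle := hB (K + 1) qc sz' p' cls hqc01 hp'01 htot (Nat.succ_pos K) hterm hreal hclsinj hclscov hEN
  -- identify the two crossing sums
  have hCB : ∀ m, m ≤ K → ∀ t : ℤ, CB[sz', p', m] t = CB[sz, p, m] t := fun m hm t =>
    BlobWalk.CB_congr₂ sz' sz p' p m (fun i hi => by simp only [hsz', if_pos (show i < K by omega)])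
      (fun i hi => by simp only [hp', if_pos (show i < K by omega)]) t
  have hsum : ∑ k ∈ Finset.range (K + 1), (∏ i ∈ Finset.range (k + 1), qc i) * p' k *
        (CB[sz', p', k] (j : ℤ) - CB[sz', p', k] ((j : ℤ) - (sz' k : ℤ))) =
      ∑ k ∈ Finset.range K, w k * p k * (CB[sz, p, k] (j : ℤ) - CB[sz, p, k] ((j : ℤ) - (sz k : ℤ))) +
        x * (CB[sz, p, K] (j : ℤ) - CB[sz, p, K] ((j : ℤ) - (c : ℤ))) := by
    rw [Finset.sum_range_succ, hWK, hCB K le_rfl, hCB K le_rfl]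
    simp only [hsz', hp', lt_irrefl, if_false, mul_one]
    congr 1
    refine Finset.sum_congr rfl fun k hk => ?_
    have hkK := Finset.mem_range.1 hk
    rw [hWk k hkK, hCB k hkK.le, hCB k hkK.le, if_pos hkK, if_pos hkK]
  rw [hsum] at hle
  exact hle

/-! ### The class `|A|·x > 2j` -/

/-- **FAR AT EVERY LAYER FOR EVERY BLOCK-COMB IN THE CLASS `|A|·x > 2j`.**  Ancestor finsets `P` of a rooted forest (`y ∈ P x → P y ⊆ P x`;
members of `P x` pairwise comparable), gates `q`, relays `A ∋ a` with `a` least likely (`∏_{P a} q ≤ ∏_{P b} q` on `A`), BLOCK-COMB around `a`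
(`P b ≠ P b' → P b ∩ P b' ⊆ P a` on `A`), and the CLASS BUDGET `2j < |A| · ∏_{P a} q` (the mean at the all-tied corner).  Then
`P(#{b ∈ A : ↑(P b) ⊆ ω} ≤ j) ≤ t` whenever `1 − ∏_{P a} q ≤ t` — lead g12's `Quant.BlockComb.tail_ge_of_class` through the transport. [this work] -/
theorem farTree_blockComb_of_classBudget (P : ι → Finset ι)
    (h2 : ∀ x, ∀ y ∈ P x, P y ⊆ P x) (h3 : ∀ x, ∀ y ∈ P x, ∀ z ∈ P x, y ∈ P z ∨ z ∈ P y)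
    (q : ι → unitInterval) (A : Finset ι) (j : ℕ) (t : ℝ) (a : ι) (ha : a ∈ A)
    (hmin : ∀ b ∈ A, ∏ y ∈ P a, (q y : ℝ) ≤ ∏ y ∈ P b, (q y : ℝ))
    (hcomb : ∀ b ∈ A, ∀ b' ∈ A, P b ≠ P b' → P b ∩ P b' ⊆ P a)
    (hclass : (2 * j : ℝ) < (A.card : ℝ) * ∏ y ∈ P a, (q y : ℝ))
    (ht : 1 - ∏ y ∈ P a, (q y : ℝ) ≤ t) :
    (prodBernoulli q).real {ω : Set ι | (A.filter fun b => ((P b : Finset ι) : Set ι) ⊆ ω).card ≤ j} ≤ t := by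
  have hmeas : ∀ T : Set (Set ι), MeasurableSet T := fun T => (Set.toFinite T).measurableSet
  have hheavy : ∏ y ∈ P a, (q y : ℝ) ≤ (prodBernoulli q).real
      {ω : Set ι | (j : ℤ) + 1 ≤ (((A.filter fun y => ((P y : Finset ι) : Set ι) ⊆ ω).card : ℕ) : ℤ)} := by
    refine farTree_blockComb_heavy_ge_of_crossing P h2 h3 q A a ha hcomb j _
      fun M qc sz p cls hqc hp htot hM _ hreal _ _ _ => ?_
    refine BlockComb.le_crossing_of_class M sz p hp qc hqc j _ (fun k hk _ => ?_) (by rw [htot]; exact hclass) ?_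
    · obtain ⟨b, hb, _, _, _, _, hmarg⟩ := hreal k hk
      rw [hmarg]; exact hmin b hb
    · obtain ⟨b, hb, hbcls, hszb, _⟩ := hreal (M - 1) (by omega)
      refine ⟨M - 1, by omega, ?_⟩
      rw [hszb]
      exact Finset.card_pos.2 ⟨b, Finset.mem_filter.2 ⟨hb, hbcls⟩⟩
  rw [blockComb_light_eq_compl P A j, probReal_compl_eq_one_sub (hmeas _)]
  linarith

/-- **The class `|A|·x > 2j` on the ESSENTIAL ancestor sets** `{y ∈ P x | q y ≠ 1}` (glued classes as weight-one paths). [this work] -/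
theorem farTree_blockComb_of_classBudget_essential {m : ℕ} (P : Fin m → Finset (Fin m))
    (h2 : ∀ x, ∀ y ∈ P x, P y ⊆ P x) (h3 : ∀ x, ∀ y ∈ P x, ∀ z ∈ P x, y ∈ P z ∨ z ∈ P y)
    (q : Fin m → unitInterval) (A : Finset (Fin m)) (j : ℕ) (t : ℝ) (a : Fin m) (ha : a ∈ A)
    (hmin : ∀ b ∈ A, ∏ y ∈ P a, (q y : ℝ) ≤ ∏ y ∈ P b, (q y : ℝ))
    (hcomb : ∀ b ∈ A, ∀ b' ∈ A, (P b).filter (fun y => q y ≠ 1) ≠ (P b').filter (fun y => q y ≠ 1) →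
      (P b).filter (fun y => q y ≠ 1) ∩ (P b').filter (fun y => q y ≠ 1) ⊆ (P a).filter (fun y => q y ≠ 1))
    (hclass : (2 * j : ℝ) < (A.card : ℝ) * ∏ y ∈ P a, (q y : ℝ))
    (ht : 1 - ∏ y ∈ P a, (q y : ℝ) ≤ t) :
    (prodBernoulli q).real {ω : Set (Fin m) | (A.filter fun b => ((P b : Finset (Fin m)) : Set (Fin m)) ⊆ ω).card ≤ j} ≤ t := by
  rw [light_real_eq_essential q P A j]
  obtain ⟨h2', h3'⟩ := essential_axioms q P h2 h3
  have hprod : ∀ b, ∏ y ∈ (P b).filter (fun y => q y ≠ 1), (q y : ℝ) = ∏ y ∈ P b, (q y : ℝ) :=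
    fun b => prod_filter_ne_one_eq q (P b)
  exact farTree_blockComb_of_classBudget (fun x => (P x).filter fun y => q y ≠ 1) h2' h3' q A j t a ha
    (fun b hb => by rw [hprod, hprod]; exact hmin b hb) hcomb (by rw [hprod]; exact hclass) (by rw [hprod]; exact ht)

/-- **FAR AT EVERY LAYER FOR EVERY BLOCK-COMB IN THE CLASS `|A|·x > 2j`, route vocabulary (`o ∉ A`).**  Weights on the pairs of `Fin n` supported on
a rooted spanning tree (`par`/`depth` coordinates of `Quant.tree_cluster_transfer`; weight `0` prunes); ESSENTIAL ancestor sets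
`E b = {par^[i] b | i ≤ depth b, w s(par ·, ·) ≠ 1}`; relays `A ∌ o` with a least likely relay `a`, combed around `a` (`E b ≠ E b' → E b ∩ E b' ⊆ E a`
on `A`), and the class budget `2j < |A| · P(o ↔ a)`.  Then `P(o ↮ b) ≤ t` on `A` gives `P(#{b ∈ A | o ↔ b} ≤ j) ≤ t` — the body of
`Quant.FarRelayRow` for every block-comb whose all-tied corner carries the mean. [this work] -/
theorem farRelayRow_tree_blockComb_of_classBudget (n : ℕ) (w : Sym2 (Fin n) → unitInterval) (o : Fin n)
    (depth : Fin n → ℕ) (par : Fin n → Fin n)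
    (hroot : ∀ x, x ≠ o → depth x = 0 → par x = o)
    (hstep : ∀ x, x ≠ o → depth x ≠ 0 → par x ≠ o ∧ depth (par x) + 1 = depth x)
    (hsupp : ∀ e, w e ≠ 0 → e.IsDiag ∨ ∃ x, x ≠ o ∧ e = s(par x, x))
    (E : Fin n → Finset (Fin n))
    (hE : ∀ b, b ≠ o → E b = ((Finset.range (depth b + 1)).image (fun i => par^[i] b)).filter fun y => w s(par y, y) ≠ 1)
    (A : Finset (Fin n)) (hoA : o ∉ A) (a : Fin n) (ha : a ∈ A)
    (hmin : ∀ b ∈ A, (prodBernoulli w).real (openConn o a) ≤ (prodBernoulli w).real (openConn o b))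
    (hcomb : ∀ b ∈ A, ∀ b' ∈ A, E b ≠ E b' → E b ∩ E b' ⊆ E a)
    (j : ℕ) (hclass : (2 * j : ℝ) < (A.card : ℝ) * (prodBernoulli w).real (openConn o a))
    (t : ℝ) (ht : ∀ b ∈ A, (prodBernoulli w).real (openConn o b : Set (BondConfig (Fin n)))ᶜ ≤ t) :
    (prodBernoulli w).real {ω : BondConfig (Fin n) | (A.filter fun b => ω ∈ openConn o b).card ≤ j} ≤ t := by
  have hAo : ∀ b ∈ A, b ≠ o := fun b hb hbo => hoA (hbo ▸ hb)
  refine farRelayRow_tree_of_gate n w o depth par hroot hstep hsupp A hoA j t fun q P hq hqo hP h1 h2 h3 hmarg => ?_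
  have hPE : ∀ b ∈ A, (P b).filter (fun y => q y ≠ 1) = E b := by
    intro b hb
    have hbo := hAo b hb
    rw [hE b hbo, hP b hbo]
    refine Finset.filter_congr fun y hy => ?_
    rw [hq y (tree_mem_ancestors_ne_root o depth par hstep b hbo y hy)]
  refine farTree_blockComb_of_classBudget_essential P h2 h3 q A j t a ha ?_ ?_ ?_ ?_
  · intro b hb; rw [hmarg a (hAo a ha), hmarg b (hAo b hb)]; exact hmin b hb
  · intro b hb b' hb'
    rw [hPE b hb, hPE b' hb', hPE a ha]
    exact hcomb b hb b' hb'
  · rw [hmarg a (hAo a ha)]; exact hclass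
  · rw [hmarg a (hAo a ha), ← probReal_compl_eq_one_sub (Set.toFinite _).measurableSet]
    exact ht a ha

end Quant

end Summit.CriticalPhenomena.PercolationContinuityZ3.Theorems

end
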